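import Summits.QuantumFields.YangMills.Theorems.BalabanUVNodesN21ThresholdMixtureRepr

/-!
# YM-DAG node N21 (= NE7c) — THE THRESHOLD MIXTURE, PART 3: design (η)'s realized SIBLING weight `T4LipschitzLedger.sibW` at the profiles
# `linProfile ∘ κ` IS the normalised threshold average of the SHARP sibling weight (band indicator at the nominal threshold × the other factors
# SHARP × the threshold-free remainder) — the (O-mix-2)∕N20 dictionary on the (η) face of the mixture road

Track A of `YM-PLAN.md` (cell `pub-ymgap`, HUMAN RULING D-0062), node **N21**; R141 (C) fan-out seat `pub-ymgap-dag-n21-e` (s3 = ALTERNATIVE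
CURRENCY), generation 2, file 9.  Companions: 5a `…N21ThresholdMixture` (p466893: `integral_fac_smallInd`), 5b `…N21ThresholdMixtureRepr` (p467851:
`termRepr_of_sharpMixture`, `measurable_smallInd_eval`), 6 ∕ 8 `…N21AtSpineCarriersMixture(TwoThresholds)` (p468321 ∕ p470362: the (η) faces, whose N20
in-edge is `T4LipschitzCutoff.SiblingSuppression … (sibW (linProfile ∘ κ) κ μ m slot pol θ u R ρ) S`).  Kernel bookkeeping + one Fubini swap: 0 `def`,
0 `sorry`, standard axioms.  COUNT-NEUTRAL; `--supports` the K3′ item `SpineGivenEndpointR12` as a helper.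

HONEST FRAMING.  NE7c is NOT PRINTED and NOT PROVED.  On the (η) face of the mixture road the two remaining in-edges are `SupClose` (N16 — threshold-free
as typed) and `SiblingSuppression` (N20, NE7b species) of the REALIZED SIBLING WEIGHTS `sibW` of the profiled representation.  This file says WHICH SHARP
OBJECT that weight is the λ-average of: for a term with factors `i < m` (slot `slot K τ i`, polarity, nominal threshold `θ_i`, width `κ_{a_i}`), the
slot-`σ` sibling weight at the profiles `linProfile κ_a` equals `(∏_j κ_{a_j}θ_j)⁻¹ · ∫ ds Σ_{i : slot i = σ} ∫ (pol i).shell(u_i v, θ_i, κ_{a_i}, ρθ_i) ·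
(∏_{j ≠ i} (pol j).fac(1[u_j v < s_j])) · R v ∂μ` — print's own kind of object: the band `[(1 − κ − ρ)θ_i, θ_i(+ρθ_i))` at the NOMINAL threshold (a
same-run large-field event at a lowered threshold, [Balaban1989LargeFieldI] p. 193) times the term's OTHER characteristic functions SHARP at thresholds
`s_j`, times the threshold-free remainder.  So N20's supplier for the mixture road is a bound on these sharp sibling weights UNIFORM over the multipliers
(lens (O-mix-2); `T4LipschitzCutoff` §5∕§7 is that worst case).  CAVEAT (located, NOT typed here): `SiblingSuppression` is CLASS-relative (`Σ_τ sibW ≤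
S·Σ_τ X`), and per-TERM domination of the sharp sibling by the sharp weight is FALSE (the band sits where the term's own factor vanishes); the transfer
of a class-relative sharp bound to the averages needs ONE common product space over all occurrences of the step (each term reading its own
coordinates) — file 5a's `relBound_mixture_of_forall` is the linear step, the marginalisation bookkeeping is the located remainder.  Nothing of
Bałaban's is asserted; N20 untouched; N21 NOT discharged; one finite four-torus programme at fixed `ε`; NOT continuum ∕ ℝ⁴ ∕ OS ∕ mass gap ∕ Clay.

CITATION HEADER (lean-in-tree rule 2026-08-18).  Everything BY NAME from the tree: `T4LipschitzCutoff.sibling` (:181) ∕ `linProfile`; `T4LipschitzLedger.Pol`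
∕ `Pol.fac` ∕ `Pol.shell` ∕ `Pol.measurable_shell` ∕ `Pol.shell_nonneg` ∕ `Pol.shell_le_one` ∕ `facAt` ∕ `sibAt` ∕ `sibW`; file 5a `integral_fac_smallInd`;
file 5b `measurable_smallInd_eval`; Mathlib `Finset.prod_Ico_consecutive`, `Finset.prod_eq_prod_Ico_succ_bot`, `Finset.prod_range`, `integral_fintype_prod_eq_prod`,
`integral_integral_swap`, `Integrable.comp_snd`, `Integrable.integral_prod_left`, `integral_finsetSum`.  Context only (SHAPE): [Balaban1988Convergent]
(2.17)∕(2.18) p. 257; [Balaban1989LargeFieldI] p. 193.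

WHAT IS PROVED ([folklore]).  `sibling_eq_prod_ite` (`sibling p n i = ∏_{j<n} (if j = i then 1 else p j)`, `i < n`) · `sharpMixture_sibling_eq` (the box
integral of the sharp sibling product is `(∏_j κ_{a_j}θ_j)·∏_j (if j = i then 1 else fac(linProfile …))` — the `i`-th threshold integrates trivially) ·
`sibling_facAt_eq_prod_ite` (the profiled sibling as that `Fin`-product) · `integrable_sharpSiblingIntegrand` · **`sibW_eq_sharpMixture`**.
-/

set_option autoImplicit false

noncomputable section

open MeasureTheory Set
open scoped BigOperators ENNReal

namespace Summit.QuantumFields.YangMills.Theorems.N21ThresholdMixtureSibling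

open Literature.MathematicalPhysics.QuantumFieldTheory.Balaban1983to89
open Literature.MathematicalPhysics.QuantumFieldTheory.Balaban1983to89.T4LipschitzCutoff
open Literature.MathematicalPhysics.QuantumFieldTheory.Balaban1983to89.T4IndicatorShell
open Literature.MathematicalPhysics.QuantumFieldTheory.Balaban1983to89.T4LipschitzLedger
open N21ThresholdMixture (integral_fac_smallInd)
open N21ThresholdMixtureRepr (measurable_smallInd_eval)

/-! ## §1 The sibling as a product with the removed factor replaced by `1` -/

/-- `T4LipschitzCutoff.sibling p n i` — the product of the run's factors with factor `i` REMOVED — is the product over all `j < n` of `p j` with the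
`i`-th factor replaced by `1` (`i < n`). [folklore] -/
theorem sibling_eq_prod_ite (p : ℕ → ℝ) {n i : ℕ} (hi : i < n) :
    sibling p n i = ∏ j ∈ Finset.range n, (if j = i then (1 : ℝ) else p j) := by
  set g : ℕ → ℝ := fun j => if j = i then (1 : ℝ) else p j with hg
  have h1 : ∏ j ∈ Finset.range n, g j = (∏ j ∈ Finset.Ico 0 i, g j) * (g i * ∏ j ∈ Finset.Ico (i + 1) n, g j) := by
    rw [Finset.range_eq_Ico, ← Finset.prod_Ico_consecutive g (Nat.zero_le i) hi.le, Finset.prod_eq_prod_Ico_succ_bot hi g]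
  have hgi : g i = 1 := by simp [hg]
  have hlo : ∏ j ∈ Finset.Ico 0 i, g j = ∏ j ∈ Finset.range i, p j := by
    rw [← Finset.range_eq_Ico]
    exact Finset.prod_congr rfl fun j hj => by simp [hg, (Finset.mem_range.1 hj).ne]
  have hhi : ∏ j ∈ Finset.Ico (i + 1) n, g j = ∏ j ∈ Finset.Ico (i + 1) n, p j :=
    Finset.prod_congr rfl fun j hj => by simp [hg, (Nat.succ_le_iff.mp (Finset.mem_Ico.1 hj).1).ne']
  rw [h1, hgi, one_mul, hlo, hhi, sibling]

/-- The PROFILED sibling of factor `i < m` at the profiles `linProfile ∘ κ`, as a product over `Fin m` with the `i`-th factor replaced by `1`.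
[folklore] -/
theorem sibling_facAt_eq_prod_ite (κ : ℕ → ℝ) {m : ℕ} (sl : ℕ → Σ _ : ℕ, ℕ) (pol : ℕ → Pol) (θ u : ℕ → ℝ) {i : ℕ} (hi : i < m) :
    sibling (facAt (fun a => linProfile (κ a)) sl pol θ u) m i =
      ∏ j : Fin m, (if (j : ℕ) = i then (1 : ℝ) else (pol j).fac (linProfile (κ (sl j).1) (u j / θ j))) := by
  rw [sibling_eq_prod_ite _ hi, ← Finset.prod_range fun j => if j = i then (1 : ℝ) else (pol j).fac (linProfile (κ (sl j).1) (u j / θ j))]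
  rfl

/-! ## §2 The box integral of the sharp sibling product -/

/-- **THE `i`-TH THRESHOLD INTEGRATES TRIVIALLY.**  Over the box `⊗_j Leb|[(1 − κ_{a_j})θ_j, θ_j]`, the product of the sharp factors `fac_j(1[u_j < s_j])`
for `j ≠ i` (and `1` for `j = i`) integrates to `(∏_j κ_{a_j}θ_j) · ∏_j (if j = i then 1 else fac_j(linProfile κ_{a_j} (u_j∕θ_j)))` — Fubini in the `m`
thresholds (`integral_fintype_prod_eq_prod`), file 5a's `integral_fac_smallInd` off `i`, `∫ 1 = κ_iθ_i` at `i`. [folklore] -/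
theorem sharpMixture_sibling_eq (κ : ℕ → ℝ) {m : ℕ} (sl : ℕ → Σ _ : ℕ, ℕ) (pol : ℕ → Pol) (θ u : ℕ → ℝ) (i : ℕ)
    (hκ0 : ∀ j < m, 0 < κ (sl j).1) (hθ : ∀ j < m, 0 < θ j) :
    ∫ s : Fin m → ℝ, ∏ j : Fin m, (if (j : ℕ) = i then (1 : ℝ) else (pol j).fac (smallInd (u j) (s j)))
        ∂(Measure.pi fun j : Fin m => volume.restrict (Icc ((1 - κ (sl j).1) * θ j) (θ j)))
      = (∏ j : Fin m, (κ (sl j).1 * θ j)) *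
          ∏ j : Fin m, (if (j : ℕ) = i then (1 : ℝ) else (pol j).fac (linProfile (κ (sl j).1) (u j / θ j))) := by
  rw [MeasureTheory.integral_fintype_prod_eq_prod (𝕜 := ℝ) (E := fun _ => ℝ)
    (fun (j : Fin m) (x : ℝ) => if (j : ℕ) = i then (1 : ℝ) else (pol j).fac (smallInd (u j) x)), ← Finset.prod_mul_distrib]
  refine Finset.prod_congr rfl fun j _ => ?_
  have hκθ : 0 < κ (sl j).1 * θ j := mul_pos (hκ0 j j.2) (hθ j j.2)
  have hθa : θ j - (1 - κ (sl j).1) * θ j = κ (sl j).1 * θ j := by ring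
  by_cases hj : (j : ℕ) = i
  · simp only [hj, if_true, integral_const, measureReal_def, Measure.restrict_apply MeasurableSet.univ, univ_inter,
      Real.volume_Icc, smul_eq_mul, mul_one]
    rw [← hj, hθa, ENNReal.toReal_ofReal hκθ.le]
  · simp only [hj, if_false]
    exact integral_fac_smallInd (pol j) (hκ0 j j.2) (hθ j j.2) (u j)

/-! ## §3 The sibling weight as a sharp mixture -/

section Realized

variable {Y : Type*} [MeasurableSpace Y]

/-- the sharp sibling product (factor `i` replaced by `1`) is jointly measurable in (thresholds, field) and takes values in `[0, 1]`. [folklore] -/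
theorem measurable_prod_ite_fac_smallInd {m : ℕ} (pol : Fin m → Pol) {u : Fin m → Y → ℝ} (hu : ∀ j, Measurable (u j)) (i : ℕ) :
    Measurable fun p : (Fin m → ℝ) × Y => ∏ j : Fin m, (if (j : ℕ) = i then (1 : ℝ) else (pol j).fac (smallInd (u j p.2) (p.1 j))) := by
  refine Finset.measurable_prod _ fun j _ => ?_
  by_cases hj : (j : ℕ) = i
  · simp only [hj, if_true]; exact measurable_const
  · simp only [hj, if_false]; exact (Pol.measurable_fac (pol j)).comp (measurable_smallInd_eval (hu j) j)

/-- … values in `[0, 1]`. [folklore] -/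
theorem prod_ite_fac_smallInd_mem_unitInterval {m : ℕ} (pol : Fin m → Pol) (u s : Fin m → ℝ) (i : ℕ) :
    0 ≤ ∏ j : Fin m, (if (j : ℕ) = i then (1 : ℝ) else (pol j).fac (smallInd (u j) (s j))) ∧
      ∏ j : Fin m, (if (j : ℕ) = i then (1 : ℝ) else (pol j).fac (smallInd (u j) (s j))) ≤ 1 := by
  refine ⟨Finset.prod_nonneg fun j _ => ?_, Finset.prod_le_one (fun j _ => ?_) fun j _ => ?_⟩
  · by_cases hj : (j : ℕ) = i
    · simp only [hj, if_true]; exact zero_le_one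
    · simp only [hj, if_false]; exact Pol.fac_nonneg (smallInd_nonneg _ _) (smallInd_le_one _ _) _
  · by_cases hj : (j : ℕ) = i
    · simp only [hj, if_true]; exact zero_le_one
    · simp only [hj, if_false]; exact Pol.fac_nonneg (smallInd_nonneg _ _) (smallInd_le_one _ _) _
  · by_cases hj : (j : ℕ) = i
    · simp only [hj, if_true]; exact le_rfl
    · simp only [hj, if_false]; exact Pol.fac_le_one (smallInd_nonneg _ _) (smallInd_le_one _ _) _

/-- **JOINT INTEGRABILITY OF THE SHARP SIBLING INTEGRAND** `(s, v) ↦ shell_i(v) · (∏_{j ≠ i} fac_j(1[u_j v < s_j])) · R v` on `(box) × (field space)`: the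
band indicator and the sharp product are measurable with values in `[0, 1]`, `R` is integrable, the box is finite. [folklore] -/
theorem integrable_sharpSiblingIntegrand {m : ℕ} (μ : Measure Y) [SFinite μ] (pol : Fin m → Pol) {u : Fin m → Y → ℝ}
    (hu : ∀ j, Measurable (u j)) {R : Y → ℝ} (hR : Integrable R μ) (lo hi : Fin m → ℝ) (i : ℕ) {sh : Y → ℝ} (hsh : Measurable sh)
    (hsh0 : ∀ v, 0 ≤ sh v) (hsh1 : ∀ v, sh v ≤ 1) :
    Integrable (Function.uncurry fun (s : Fin m → ℝ) (v : Y) =>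
        sh v * (∏ j : Fin m, (if (j : ℕ) = i then (1 : ℝ) else (pol j).fac (smallInd (u j v) (s j)))) * R v)
      ((Measure.pi fun j : Fin m => volume.restrict (Icc (lo j) (hi j))).prod μ) := by
  have hR2 : Integrable (fun p : (Fin m → ℝ) × Y => R p.2)
      ((Measure.pi fun j : Fin m => volume.restrict (Icc (lo j) (hi j))).prod μ) :=
    hR.comp_snd (Measure.pi fun j : Fin m => volume.restrict (Icc (lo j) (hi j)))
  have hmeas : Measurable fun p : (Fin m → ℝ) × Y =>
      sh p.2 * ∏ j : Fin m, (if (j : ℕ) = i then (1 : ℝ) else (pol j).fac (smallInd (u j p.2) (p.1 j))) :=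
    (hsh.comp measurable_snd).mul (measurable_prod_ite_fac_smallInd pol hu i)
  refine hR2.norm.mono' (hmeas.aestronglyMeasurable.mul hR2.aestronglyMeasurable) (ae_of_all _ fun p => ?_)
  obtain ⟨s, v⟩ := p
  have h01 := prod_ite_fac_smallInd_mem_unitInterval pol (fun j => u j v) s i
  show ‖sh v * (∏ j : Fin m, (if (j : ℕ) = i then (1 : ℝ) else (pol j).fac (smallInd (u j v) (s j)))) * R v‖ ≤ ‖R v‖
  rw [norm_mul, Real.norm_of_nonneg (mul_nonneg (hsh0 v) h01.1)]
  exact mul_le_of_le_one_left (norm_nonneg _) (mul_le_one₀ (hsh1 v) h01.1 h01.2)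

variable {ι : Type*} {Ω : ℕ → ι → Type*} [∀ K τ, MeasurableSpace (Ω K τ)]

/-- **THE REALIZED SIBLING WEIGHT OF DESIGN (η) IS A SHARP MIXTURE.**  For one run with term data `(μ, m, slot, pol, θ, uX, RX)` as in
`T4LipschitzLedger.TermRepr` (thresholds positive, tested variables measurable, remainder integrable, measures s-finite) and admissible widths `0 < κ_a`:
the slot-`σ` sibling weight at the profiles `linProfile ∘ κ` and relative width `ρ`,
`sibW (fun a => linProfile (κ a)) κ μ m slot pol θ uX RX ρ σ K t τ`, EQUALS the normalised box average
`(∏_j κ_{a_j}θ_j)⁻¹ · ∫ ds Σ_{i : slot K τ i = σ} ∫ (pol K τ i).shell (uX_i v) θ_i κ_{a_i} (ρ(K − a_i)θ_i) · (∏_{j ≠ i} (pol K τ j).fac (1[uX_j v < s_j])) · RX v ∂μ`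
of the SHARP sibling weight (band at the nominal threshold × the other factors sharp × the threshold-free remainder) — `sibling_facAt_eq_prod_ite`,
`sharpMixture_sibling_eq` and ONE Fubini swap per factor.  This is the object N20's supplier bounds, uniformly in the multipliers, on the mixture road
((O-mix-2)); the class-relative transfer to `SiblingSuppression` is NOT typed here (see the header's caveat). [folklore] -/
theorem sibW_eq_sharpMixture {κ : ℕ → ℝ} {μ : (K : ℕ) → (τ : ι) → Measure (Ω K τ)} [∀ K τ, SFinite (μ K τ)] {m : ℕ → ι → ℕ}
    {slot : ℕ → ι → ℕ → Σ _ : ℕ, ℕ} {pol : ℕ → ι → ℕ → Pol} {θ : ℕ → ι → ℕ → ℝ} {uX : (K : ℕ) → (τ : ι) → ℕ → Ω K τ → ℝ}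
    {RX : (K : ℕ) → ℝ → (τ : ι) → Ω K τ → ℝ} {ρ : ℕ → ℝ} (hκ : ∀ a, 0 < κ a) (K : ℕ) (t : ℝ) (τ : ι)
    (thr_pos : ∀ i < m K τ, 0 < θ K τ i) (meas : ∀ i < m K τ, Measurable (uX K τ i)) (rem_int : Integrable (RX K t τ) (μ K τ))
    (σ : Σ _ : ℕ, ℕ) :
    sibW (fun a => linProfile (κ a)) κ μ m slot pol θ uX RX ρ σ K t τ =
      (∏ j : Fin (m K τ), (κ (slot K τ j).1 * θ K τ j))⁻¹ *
        ∫ s, (∑ i ∈ (Finset.range (m K τ)).filter (fun i => slot K τ i = σ),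
          ∫ v, (pol K τ i).shell (uX K τ i v) (θ K τ i) (κ (slot K τ i).1) (ρ (K - (slot K τ i).1) * θ K τ i) *
            (∏ j : Fin (m K τ), (if (j : ℕ) = i then (1 : ℝ) else (pol K τ j).fac (smallInd (uX K τ j v) (s j)))) *
              RX K t τ v ∂(μ K τ))
          ∂(Measure.pi fun j : Fin (m K τ) => volume.restrict (Icc ((1 - κ (slot K τ j).1) * θ K τ j) (θ K τ j))) := by
  set π : Measure (Fin (m K τ) → ℝ) :=
    Measure.pi fun j : Fin (m K τ) => volume.restrict (Icc ((1 - κ (slot K τ j).1) * θ K τ j) (θ K τ j)) with hπ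
  set c : ℝ := ∏ j : Fin (m K τ), (κ (slot K τ j).1 * θ K τ j) with hc
  have hcpos : 0 < c := Finset.prod_pos fun j _ => mul_pos (hκ _) (thr_pos j j.2)
  -- the per-factor sharp sibling integrand and its joint integrability
  have hint : ∀ i ∈ (Finset.range (m K τ)).filter (fun i => slot K τ i = σ),
      Integrable (Function.uncurry fun (s : Fin (m K τ) → ℝ) (v : Ω K τ) =>
        (pol K τ i).shell (uX K τ i v) (θ K τ i) (κ (slot K τ i).1) (ρ (K - (slot K τ i).1) * θ K τ i) *
          (∏ j : Fin (m K τ), (if (j : ℕ) = i then (1 : ℝ) else (pol K τ j).fac (smallInd (uX K τ j v) (s j)))) * RX K t τ v)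
        (π.prod (μ K τ)) := by
    intro i hi
    have him : i < m K τ := Finset.mem_range.1 (Finset.mem_filter.1 hi).1
    exact integrable_sharpSiblingIntegrand (μ K τ) (fun j : Fin (m K τ) => pol K τ j) (u := fun j => uX K τ j)
      (fun j => meas j j.2) rem_int _ _ i (Pol.measurable_shell (meas i him) _ _ _ _) (fun v => Pol.shell_nonneg _ _ _ _ _)
      (fun v => Pol.shell_le_one _ _ _ _ _)
  have hint' : ∀ i ∈ (Finset.range (m K τ)).filter (fun i => slot K τ i = σ),
      Integrable (fun s : Fin (m K τ) → ℝ =>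
        ∫ v, (pol K τ i).shell (uX K τ i v) (θ K τ i) (κ (slot K τ i).1) (ρ (K - (slot K τ i).1) * θ K τ i) *
          (∏ j : Fin (m K τ), (if (j : ℕ) = i then (1 : ℝ) else (pol K τ j).fac (smallInd (uX K τ j v) (s j)))) * RX K t τ v ∂(μ K τ)) π :=
    fun i hi => (hint i hi).integral_prod_left
  -- pull the finite sum out of the box integral
  rw [integral_finsetSum _ hint', Finset.mul_sum, sibW]
  refine Finset.sum_congr rfl fun i hi => ?_
  have him : i < m K τ := Finset.mem_range.1 (Finset.mem_filter.1 hi).1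
  -- Fubini for factor `i`
  rw [integral_integral_swap (hint i hi)]
  -- the inner box integral, pointwise in the field
  have hinner : (fun v => ∫ s, (pol K τ i).shell (uX K τ i v) (θ K τ i) (κ (slot K τ i).1) (ρ (K - (slot K τ i).1) * θ K τ i) *
        (∏ j : Fin (m K τ), (if (j : ℕ) = i then (1 : ℝ) else (pol K τ j).fac (smallInd (uX K τ j v) (s j)))) * RX K t τ v ∂π) =
      fun v => c * (sibAt (fun a => linProfile (κ a)) κ (slot K τ) (pol K τ) (θ K τ) (fun j => uX K τ j v)
        (ρ (K - (slot K τ i).1)) (m K τ) i * RX K t τ v) := by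
    funext v
    have hswap : (fun s : Fin (m K τ) → ℝ => (pol K τ i).shell (uX K τ i v) (θ K τ i) (κ (slot K τ i).1) (ρ (K - (slot K τ i).1) * θ K τ i) *
          (∏ j : Fin (m K τ), (if (j : ℕ) = i then (1 : ℝ) else (pol K τ j).fac (smallInd (uX K τ j v) (s j)))) * RX K t τ v) =
        fun s => (∏ j : Fin (m K τ), (if (j : ℕ) = i then (1 : ℝ) else (pol K τ j).fac (smallInd (uX K τ j v) (s j)))) *
          ((pol K τ i).shell (uX K τ i v) (θ K τ i) (κ (slot K τ i).1) (ρ (K - (slot K τ i).1) * θ K τ i) * RX K t τ v) := by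
      funext s; ring
    rw [hswap, integral_mul_const, sharpMixture_sibling_eq κ (slot K τ) (pol K τ) (θ K τ) (fun j => uX K τ j v) i
      (fun j _ => hκ _) thr_pos, ← sibling_facAt_eq_prod_ite κ (slot K τ) (pol K τ) (θ K τ) (fun j => uX K τ j v) him, hc, sibAt]
    ring
  rw [hinner, integral_const_mul, ← mul_assoc, inv_mul_cancel₀ hcpos.ne', one_mul]

end Realized

end Summit.QuantumFields.YangMills.Theorems.N21ThresholdMixtureSibling

end
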